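import Literature.Analysis.FluidPDE.SteadyLiouvilleTsaiVorticity
import Literature.Analysis.FluidPDE.MixedNormHolder
import HarnessLib

/-!
# Interior `L^s` and `L_{s,n}` estimates for the gradient of a pressure solving `Δq = div F`

Analysis/FluidPDE support file (everything proved, no definitions, no named facts) on the
discharge path of the named fact `Literature.Analysis.FluidPDE.StokesLocalHolderBound`
(`FluidPDE/SereginLocalStokesRegularity`; G. Seregin, *Lecture notes on regularity theory for
the Navier–Stokes equations* (2014), §4.6, Prop. 6.7 & 6.8). In the proof of Prop. 6.7 (p. 59)
the pressure of the linear Stokes system `∂ₜu - Δu + ∇p = f`, `div u = 0` satisfies, at each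
time, the Poisson equation

  `Δp = div f`   in the ball,

and the local theory bounds `∇p` in `L_s` of a smaller ball by `‖f‖_{L_s}` and a lower-order
norm of `p` (Seregin, (4.6.5)–(4.6.6) with the coercive estimates of the Laplacian; in print the
whole `W^{2,1}_{s,n}` estimate (4.6.4) is derived, of which this is the pressure half at fixed
time). This file proves that **slice estimate for smooth data**, and its time-integrated
**mixed-norm form**, from the tree's fixed-scale Green representation `g = N[Δg] + Λ[g]`
(`eq_newtonNearPotential_laplacian_add`, truncated Newtonian potential `N = Γ₀ ⋆` and smoothing
remainder `Λ = λ ⋆` of `FluidPDE/NewtonLocalPotential`) and the operator kit of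
`FluidPDE/SteadyLiouvilleTsaiKit` (Young bounds (N0), (N1), (Λ0), (Λ1) and the Calderón–Zygmund
bound (N2) `‖N[∂ₐ∂_b g]‖_p ≤ C‖g‖_p`, Stein 1970, III §1.3 Prop. 3, PROVED in the tree as
`stein1970_hessian_Lp_bound_holds_fin3`), exactly as the tree's pressure-independent vorticity
estimate `Tsai2021.vorticity_cutoff_bound`:

* `pressure_gradient_cutoff_bound` — for radii `0 < r₀ < r₁`, `1 < p < ∞` and a cut-off
  `χ ∈ C_c^∞` supported in the measurable set `K`, there is `C` such that for all smooth `q`,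
  `F` with `Δq = div F` on an open set `U ⊇ tsupport χ` and all `‖b‖ ≤ 1`,
  `‖χ ∂_b q‖_{L^p(ℝ³)} ≤ C (‖q‖_{L^p(K)} + ‖F‖_{L^p(K)})`
  (`χ∂_bq = N[Δ(χ∂_bq)] + Λ[χ∂_bq]`, `Δ(χ∂_bq) = χ Σₗ∂_b∂ₗFₗ + 2Σₗ∂ₗχ ∂ₗ∂_bq + (Δχ)∂_bq`, and
  the "move" lemmas (M1), (M2), (L1) of the kit);
* `eLpNorm_fderiv_pressure_ball_le` — the same with `χ = 1` on `B̄(x₀, ρ)`, supported in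
  `B(x₀, R₁)`: `‖∂_b q‖_{L^p(B(x₀,ρ))} ≤ C (‖q‖_{L^p(B(x₀,R₁))} + ‖F‖_{L^p(B(x₀,R₁))})`;
* `mixedNorm_fderiv_pressure_le` — **the mixed-norm form**: for jointly continuous `P`, `F` on
  `ℝ × ℝ³`, smooth in `x`, with `Δₓ P(t,·) = div F(t,·)` on `B(x₀, R₁)` for `t ∈ ]t₁ - ρ², t₁[`,
  `‖D_x P‖_{s,n,Q((t₁,x₀),ρ)} ≤ C (‖P‖_{s,n,Q((t₁,x₀),R₁)} + ‖F‖_{s,n,Q((t₁,x₀),R₁)})`, `1 < s < ∞`,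
  `1 ≤ n` (the slice bound integrated in time, Minkowski in `L_n`).

Constants depend on `p`/`s`, `ρ`, `R₁` (and the fixed cut-off), never on the solution or on
`t₁`; this is all the final assembly needs (the spatial centre `x₀` is fixed there).

## References

* G. Seregin, *Lecture notes on regularity theory for the Navier–Stokes equations*, World
  Scientific (2014), §4.6, proof of Prop. 6.7, p. 59 (`Δp = div f`; (4.6.5)–(4.6.6)).
  [`Seregin2014`]
* E. M. Stein, *Singular integrals and differentiability properties of functions* (1970),
  Ch. III §1.3, Prop. 3. [`Stein1971`]
* D. Gilbarg, N. S. Trudinger, *Elliptic partial differential equations of second order* (2001),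
  (2.16)–(2.17), Lemma 4.1 (Green's representation; first derivatives of potentials).
  [`GilbargTrudinger2001`]
-/

noncomputable section

open MeasureTheory Set Filter Function Metric InnerProductSpace Topology
open scoped ENNReal NNReal RealInnerProductSpace Laplacian ContDiff Convolution

namespace Literature.Analysis.FluidPDE

open Tsai2021

/-! ### Two small additions to the operator kit -/

section Kit

variable {r₀ r₁ : ℝ} {p : ℝ≥0∞}

/-- `‖N[Σₗ fₗ]‖_p ≤ Σₗ ‖N[fₗ]‖_p` for continuous densities. [folklore] -/
theorem eLpNorm_newtonNearPotential_sum_le (h₀ : 0 ≤ r₀) (h₁ : r₀ < r₁) (hp : 1 ≤ p)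
    {ι : Type*} (s : Finset ι) {G : ι → (EuclideanSpace ℝ (Fin 3)) → ℝ} (hG : ∀ l, Continuous (G l)) :
    eLpNorm (newtonNearPotential r₀ r₁ fun x => ∑ l ∈ s, G l x) p volume ≤
      ∑ l ∈ s, eLpNorm (newtonNearPotential r₀ r₁ (G l)) p volume := by
  classical
  induction s using Finset.induction_on with
  | empty =>
    simp only [Finset.sum_empty]
    have h0 : (newtonNearPotential r₀ r₁ fun _ : (EuclideanSpace ℝ (Fin 3)) => (0 : ℝ)) = 0 := by
      funext x; simp [newtonNearPotential_apply]
    rw [h0, eLpNorm_zero]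
  | insert a s ha ih =>
    simp only [Finset.sum_insert ha]
    have hrest : Continuous fun x => ∑ l ∈ s, G l x := continuous_finsetSum s fun l _ => hG l
    exact (eLpNorm_newtonNearPotential_add_le h₀ h₁ hp (hG a) hrest).trans (add_le_add le_rfl ih)

/-- The directional derivative of the divergence of a smooth field, in coordinates:
`∂_b (div F) = Σₗ ∂_b∂ₗFₗ`. [folklore] -/
theorem fderiv_divergence_apply_eq_sum {F : (EuclideanSpace ℝ (Fin 3)) → (EuclideanSpace ℝ (Fin 3))} (hF : ContDiff ℝ ∞ F) (x b : (EuclideanSpace ℝ (Fin 3))) :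
    fderiv ℝ (VectorCalculus.divergence F) x b =
      ∑ l : Fin 3, fderiv ℝ (fun y => fderiv ℝ (fun z => F z l) y (EuclideanSpace.single (l : Fin 3) (1 : ℝ))) x b := by
  have hFd : Differentiable ℝ F := hF.differentiable (by norm_cast)
  have hFl : ∀ l : Fin 3, ContDiff ℝ ∞ fun y => F y l := fun l => contDiff_euclidean.1 hF l
  have hfun : VectorCalculus.divergence F =
      fun y => ∑ l : Fin 3, fderiv ℝ (fun z => F z l) y (EuclideanSpace.single (l : Fin 3) (1 : ℝ)) :=
    funext fun y => divergence_eq_sum_coord hFd y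
  have hd : ∀ l : Fin 3, DifferentiableAt ℝ (fun y => fderiv ℝ (fun z => F z l) y (EuclideanSpace.single (l : Fin 3) (1 : ℝ))) x :=
    fun l => (contDiff_pd (hFl l) _).differentiable (by norm_cast) x
  rw [hfun, fderiv_fun_sum fun l _ => hd l, _root_.FunLike.coe_sum, Finset.sum_apply]

end Kit

/-! ### The localised pressure gradient in `L^p` -/

section Slice

variable {r₀ r₁ : ℝ} {p : ℝ≥0∞}

/-- **The localised pressure gradient is controlled in `L^p` by the pressure and the force.**
For radii `0 < r₀ < r₁`, `1 < p < ∞` and a cut-off `χ ∈ C_c^∞` supported in the measurable set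
`K` there is `C` such that: for all smooth `q : (EuclideanSpace ℝ (Fin 3)) → ℝ`, `F : (EuclideanSpace ℝ (Fin 3)) → (EuclideanSpace ℝ (Fin 3))` with `Δq = div F` on an
open set `U ⊇ tsupport χ`, and every `‖b‖ ≤ 1`,
`‖χ ∂_b q‖_{L^p((EuclideanSpace ℝ (Fin 3)))} ≤ C (‖q‖_{L^p(K)} + ‖F‖_{L^p(K)})`.
Proof: Green's representation at a fixed scale `χ∂_bq = N[Δ(χ∂_bq)] + Λ[χ∂_bq]`, the expansion
`Δ(χ∂_bq) = χ Σₗ ∂_b∂ₗFₗ + 2Σₗ ∂ₗχ ∂ₗ∂_bq + (Δχ) ∂_bq` (`Δ∂_b q = ∂_bΔq = ∂_b div F` on `U`), and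
the operator bounds of the kit after moving the cut-offs through the derivatives: the `F`-term
by Calderón–Zygmund (M2), the `q`-terms by (M2), (M1), (L1) (Seregin 2014, proof of Prop. 6.7,
p. 59: the elliptic estimate for `Δp = div f`; Stein 1970, III §1.3 Prop. 3). [cite: Seregin2014, §4.6 proof of Prop. 6.7 (p. 59); Stein1971, Ch. III §1.3 Prop 3] -/
theorem pressure_gradient_cutoff_bound (h₀ : 0 < r₀) (h₁ : r₀ < r₁) (hp : 1 < p) (hp' : p < ⊤)
    {χ : (EuclideanSpace ℝ (Fin 3)) → ℝ} (hχ : ContDiff ℝ ∞ χ) (hχc : HasCompactSupport χ) {K : Set (EuclideanSpace ℝ (Fin 3))}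
    (hK : MeasurableSet K) (hχK : tsupport χ ⊆ K) :
    ∃ C : ℝ≥0, ∀ (q : (EuclideanSpace ℝ (Fin 3)) → ℝ) (F : (EuclideanSpace ℝ (Fin 3)) → (EuclideanSpace ℝ (Fin 3))) (U : Set (EuclideanSpace ℝ (Fin 3))), ContDiff ℝ ∞ q → ContDiff ℝ ∞ F →
      IsOpen U → tsupport χ ⊆ U → (∀ x ∈ U, (Δ q) x = VectorCalculus.divergence F x) →
      ∀ b : (EuclideanSpace ℝ (Fin 3)), ‖b‖ ≤ 1 →
        eLpNorm (fun x => χ x * fderiv ℝ q x b) p volume ≤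
          C * (eLpNorm q p (volume.restrict K) + eLpNorm F p (volume.restrict K)) := by
  have hp1 : 1 ≤ p := hp.le
  obtain ⟨C, hN0, hN1, hN2, hΛ0, hΛ1⟩ := exists_operator_bounds h₀ h₁ hp hp'
  obtain ⟨M, hM0, ⟨hχ0, hχ1, hχ2⟩, hχl, ⟨hd0, hd1, -⟩⟩ := exists_cutoff_bound hχ hχc
  refine ⟨C * M.toNNReal * 40, fun q F U hq hF hU hχU hEq b hb => ?_⟩
  have he : ∀ l : Fin 3, ‖(EuclideanSpace.single (l : Fin 3) (1 : ℝ))‖ ≤ 1 := fun l => (norm_single_one l).le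
  have hFl : ∀ l : Fin 3, ContDiff ℝ ∞ fun y => F y l := fun l => contDiff_euclidean.1 hF l
  have hχ2' : ContDiff ℝ 2 χ := hχ.of_le (by norm_cast)
  -- the data of `χ`: `∂ₗχ` and `Δχ` are again smooth cut-offs supported in `K`
  have hψl : ∀ l : Fin 3, ContDiff ℝ ∞ fun y => fderiv ℝ χ y (EuclideanSpace.single (l : Fin 3) (1 : ℝ)) := fun l => contDiff_pd hχ _
  have hψlc : ∀ l : Fin 3, HasCompactSupport fun y => fderiv ℝ χ y (EuclideanSpace.single (l : Fin 3) (1 : ℝ)) := fun l =>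
    hasCompactSupport_pd hχc _
  have hψlK : ∀ l : Fin 3, tsupport (fun y => fderiv ℝ χ y (EuclideanSpace.single (l : Fin 3) (1 : ℝ))) ⊆ K := fun l =>
    (tsupport_pd_subset χ _).trans hχK
  have hΔχ : ContDiff ℝ ∞ (Δ χ) := contDiff_laplacian hχ
  have hΔχK : tsupport (Δ χ) ⊆ K := (tsupport_laplacian_subset χ).trans hχK
  -- abbreviations
  set B : ℝ≥0∞ := eLpNorm q p (volume.restrict K) + eLpNorm F p (volume.restrict K) with hB
  set X : ℝ≥0∞ := C * ENNReal.ofReal M * B with hX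
  have hXq : C * ENNReal.ofReal M * eLpNorm q p (volume.restrict K) ≤ X := by
    rw [hX]; gcongr; exact le_self_add
  have hXF : ∀ l : Fin 3, C * ENNReal.ofReal M * eLpNorm (fun y => F y l) p (volume.restrict K) ≤ X :=
    fun l => by rw [hX]; gcongr; exact (eLpNorm_apply_le F l p _).trans le_add_self
  -- the quantity `g = ∂_b q` and its localisation
  set g : (EuclideanSpace ℝ (Fin 3)) → ℝ := fun x => fderiv ℝ q x b with hg
  have hgs : ContDiff ℝ ∞ g := contDiff_pd hq b
  have hΩs : ContDiff ℝ ∞ fun x => χ x * g x := hχ.mul hgs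
  have hrep : (fun x => χ x * g x) = fun x =>
      newtonNearPotential r₀ r₁ (Δ fun y => χ y * g y) x +
        newtonFarSmoothing r₀ r₁ (fun y => χ y * g y) x :=
    funext fun x => eq_newtonNearPotential_laplacian_add h₀ h₁ (hΩs.of_le (by norm_cast)) x
  have hgoal : (fun x => χ x * fderiv ℝ q x b) = fun x => χ x * g x := rfl
  rw [hgoal, hrep]
  ----------------------------------------------------------------
  -- (I) the smoothing part `Λ[χ ∂_b q]`: (L1)
  ----------------------------------------------------------------
  have hΛpart : eLpNorm (newtonFarSmoothing r₀ r₁ fun y => χ y * g y) p volume ≤ 2 * X :=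
    (eLpNorm_newtonFarSmoothing_mul_pd_le h₀ h₁ hp1 hΛ0 hΛ1 hχ hK hχK hχ0 hχ1 hq hb).trans
      (by gcongr)
  ----------------------------------------------------------------
  -- (II) the expansion of `Δ(χ ∂_b q)`
  ----------------------------------------------------------------
  set T1 : Fin 3 → (EuclideanSpace ℝ (Fin 3)) → ℝ := fun l x =>
    χ x * fderiv ℝ (fun y => fderiv ℝ (fun z => F z l) y (EuclideanSpace.single (l : Fin 3) (1 : ℝ))) x b with hT1
  set T2 : Fin 3 → (EuclideanSpace ℝ (Fin 3)) → ℝ := fun l x =>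
    fderiv ℝ χ x (EuclideanSpace.single (l : Fin 3) (1 : ℝ)) * fderiv ℝ (fun y => fderiv ℝ q y b) x (EuclideanSpace.single (l : Fin 3) (1 : ℝ)) with hT2
  set T3 : (EuclideanSpace ℝ (Fin 3)) → ℝ := fun x => (Δ χ) x * fderiv ℝ q x b with hT3
  have hT1c : ∀ l, Continuous (T1 l) := fun l =>
    hχ.continuous.mul (contDiff_pd (contDiff_pd (hFl l) _) _).continuous
  have hT2c : ∀ l, Continuous (T2 l) := fun l =>
    (hψl l).continuous.mul (contDiff_pd (contDiff_pd hq _) _).continuous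
  have hT3c : Continuous T3 := hΔχ.continuous.mul (contDiff_pd hq _).continuous
  have hS1c : Continuous fun x => ∑ l : Fin 3, T1 l x := continuous_finsetSum _ fun l _ => hT1c l
  have hS2c : Continuous fun x => 2 * ∑ l : Fin 3, T2 l x :=
    continuous_const.mul (continuous_finsetSum _ fun l _ => hT2c l)
  have hS23c : Continuous fun x => 2 * (∑ l : Fin 3, T2 l x) + T3 x := hS2c.add hT3c
  have hallc : Continuous fun x => (∑ l : Fin 3, T1 l x) + (2 * (∑ l : Fin 3, T2 l x) + T3 x) :=
    hS1c.add hS23c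
  -- `χ Δ(∂_b q) = χ ∂_b Δq = χ ∂_b div F = Σₗ χ ∂_b∂ₗFₗ` (the equation, on `U ⊇ tsupport χ`)
  have hkey : ∀ x, χ x * (Δ g) x = ∑ l : Fin 3, T1 l x := by
    intro x
    by_cases hx : x ∈ U
    · have h1 : (Δ g) x = fderiv ℝ (Δ q) x b := (fderiv_laplacian_apply (hq.of_le (by norm_cast)) x b).symm
      have h2 : fderiv ℝ (Δ q) x b = fderiv ℝ (VectorCalculus.divergence F) x b := by
        have hev : (Δ q) =ᶠ[𝓝 x] VectorCalculus.divergence F :=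
          Filter.eventuallyEq_of_mem (hU.mem_nhds hx) fun y hy => hEq y hy
        rw [hev.fderiv_eq]
      rw [h1, h2, fderiv_divergence_apply_eq_sum hF x b, Finset.mul_sum]
    · have hx' : x ∉ tsupport χ := fun h => hx (hχU h)
      have hχx : χ x = 0 := image_eq_zero_of_notMem_tsupport hx'
      simp [hT1, hχx]
  have hexp : (Δ fun y => χ y * g y) = fun x =>
      (∑ l : Fin 3, T1 l x) + (2 * (∑ l : Fin 3, T2 l x) + T3 x) := by
    funext x
    rw [Tsai2021.laplacian_mul_eq hχ2' (hgs.of_le (by norm_cast)) x, hkey x]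
    simp only [hT2, hT3, hg]
    ring
  ----------------------------------------------------------------
  -- (III) the potential part `N[Δ(χ ∂_b q)]`
  ----------------------------------------------------------------
  have hNpart : eLpNorm (newtonNearPotential r₀ r₁ (Δ fun y => χ y * g y)) p volume ≤
      (∑ _l : Fin 3, 4 * X) + (2 * (∑ _l : Fin 3, 4 * X) + 2 * X) := by
    rw [hexp]
    refine (eLpNorm_newtonNearPotential_add_le h₀.le h₁ hp1 hS1c hS23c).trans ?_
    refine add_le_add ?_ ((eLpNorm_newtonNearPotential_add_le h₀.le h₁ hp1
      hS2c hT3c).trans (add_le_add ?_ ?_))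
    · refine (eLpNorm_newtonNearPotential_sum_le h₀.le h₁ hp1 _ hT1c).trans ?_
      refine Finset.sum_le_sum fun l _ => ?_
      exact (eLpNorm_newtonNearPotential_mul_pd_pd_le h₀ h₁ hp1 hN0 hN1 hN2 hχ hχc hK hχK
        hχ0 hχ1 hχ2 (hFl l) hb (he l)).trans (by gcongr; exact hXF l)
    · rw [eLpNorm_newtonNearPotential_const_mul]
      have e2 : ‖(2 : ℝ)‖ₑ = 2 := by
        rw [Real.enorm_eq_ofReal zero_le_two]; norm_num
      rw [e2]
      gcongr
      refine (eLpNorm_newtonNearPotential_sum_le h₀.le h₁ hp1 _ hT2c).trans ?_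
      refine Finset.sum_le_sum fun l _ => ?_
      obtain ⟨hl0, hl1, hl2⟩ := hχl l
      exact (eLpNorm_newtonNearPotential_mul_pd_pd_le h₀ h₁ hp1 hN0 hN1 hN2 (hψl l) (hψlc l) hK
        (hψlK l) hl0 hl1 hl2 hq (he l) hb).trans (by gcongr)
    · exact (eLpNorm_newtonNearPotential_mul_pd_le h₀ h₁ hp1 hN0 hN1 hΔχ
        (hasCompactSupport_laplacian hχc) hK hΔχK hd0 hd1 hq hb).trans (by gcongr)
  ----------------------------------------------------------------
  -- (IV) collecting
  ----------------------------------------------------------------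
  have hm1 : AEStronglyMeasurable (newtonNearPotential r₀ r₁ (Δ fun y => χ y * g y)) volume := by
    rw [hexp]
    exact (continuous_newtonNearPotential h₀.le h₁ hallc).aestronglyMeasurable
  have hm2 : AEStronglyMeasurable (newtonFarSmoothing r₀ r₁ fun y => χ y * g y) volume :=
    (continuous_newtonFarSmoothing h₀ h₁ hΩs.continuous).aestronglyMeasurable
  refine (eLpNorm_add_le hm1 hm2 hp1).trans ((add_le_add hNpart hΛpart).trans ?_)
  simp only [Finset.sum_const, Finset.card_univ, Fintype.card_fin, nsmul_eq_mul, Nat.cast_ofNat]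
  have hconst : ((C * M.toNNReal * 40 : ℝ≥0) : ℝ≥0∞) * B = 40 * X := by
    rw [hX, ENNReal.coe_mul, ENNReal.coe_mul]
    simp only [ENNReal.ofReal]
    push_cast
    ring
  rw [hconst]
  apply le_of_eq
  ring

/-- **Interior `L^p` bound for the pressure gradient on concentric balls.** For `1 < p < ∞`,
radii `0 < ρ < R₁` and a centre `x₀` there is `C` such that for all smooth `q`, `F` with
`Δq = div F` on `B(x₀, R₁)` and all `‖b‖ ≤ 1`,
`‖∂_b q‖_{L^p(B(x₀,ρ))} ≤ C (‖q‖_{L^p(B(x₀,R₁))} + ‖F‖_{L^p(B(x₀,R₁))})`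
(`pressure_gradient_cutoff_bound` with a bump equal to `1` on `B̄(x₀,ρ)` and supported in
`B̄(x₀,(ρ+R₁)/2)`; Seregin 2014, proof of Prop. 6.7). [cite: Seregin2014, §4.6 proof of Prop. 6.7 (p. 59); Stein1971, Ch. III §1.3 Prop 3] -/
theorem eLpNorm_fderiv_pressure_ball_le {p : ℝ≥0∞} (hp : 1 < p) (hp' : p < ⊤) {ρ R₁ : ℝ}
    (hρ : 0 < ρ) (hρR : ρ < R₁) (x₀ : (EuclideanSpace ℝ (Fin 3))) :
    ∃ C : ℝ≥0, ∀ (q : (EuclideanSpace ℝ (Fin 3)) → ℝ) (F : (EuclideanSpace ℝ (Fin 3)) → (EuclideanSpace ℝ (Fin 3))), ContDiff ℝ ∞ q → ContDiff ℝ ∞ F →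
      (∀ x ∈ ball x₀ R₁, (Δ q) x = VectorCalculus.divergence F x) → ∀ b : (EuclideanSpace ℝ (Fin 3)), ‖b‖ ≤ 1 →
        eLpNorm (fun x => fderiv ℝ q x b) p (volume.restrict (ball x₀ ρ)) ≤
          C * (eLpNorm q p (volume.restrict (ball x₀ R₁)) +
            eLpNorm F p (volume.restrict (ball x₀ R₁))) := by
  -- the cut-off
  have hρ' : ρ < (ρ + R₁) / 2 := by linarith
  set χb : ContDiffBump x₀ := ⟨ρ, (ρ + R₁) / 2, hρ, hρ'⟩ with hχb
  set χ : (EuclideanSpace ℝ (Fin 3)) → ℝ := ⇑χb with hχdef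
  have hχ : ContDiff ℝ ∞ χ := χb.contDiff
  have hχc : HasCompactSupport χ := χb.hasCompactSupport
  have hχt : tsupport χ = closedBall x₀ ((ρ + R₁) / 2) := χb.tsupport_eq
  have hK : MeasurableSet (ball x₀ R₁) := measurableSet_ball
  have hχK : tsupport χ ⊆ ball x₀ R₁ := by
    rw [hχt]; exact closedBall_subset_ball (by linarith)
  obtain ⟨C, hC⟩ := pressure_gradient_cutoff_bound (p := p) one_pos one_lt_two hp hp' hχ hχc hK hχK
  refine ⟨C, fun q F hq hF hEq b hb => ?_⟩
  have key := hC q F (ball x₀ R₁) hq hF isOpen_ball hχK hEq b hb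
  refine le_trans ?_ key
  -- on `B(x₀, ρ)` the cut-off is `1`
  rw [← eLpNorm_indicator_eq_eLpNorm_restrict measurableSet_ball]
  refine eLpNorm_mono fun x => ?_
  by_cases hx : x ∈ ball x₀ ρ
  · rw [indicator_of_mem hx]
    have h1 : χ x = 1 := χb.one_of_mem_closedBall (ball_subset_closedBall hx)
    rw [h1, one_mul]
  · rw [indicator_of_notMem hx, norm_zero]
    exact norm_nonneg _

end Slice

/-! ### The mixed-norm form: integrating the slice bound in time -/

section Mixed

/-- `‖Df(x)‖ ≤ Σₗ ‖∂ₗ f(x)‖` (operator norm of the differential of a scalar function against the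
directional derivatives along an orthonormal basis). [folklore] -/
theorem norm_fderiv_le_sum_basisFun (f : (EuclideanSpace ℝ (Fin 3)) → ℝ) (x : (EuclideanSpace ℝ (Fin 3))) :
    ‖fderiv ℝ f x‖ ≤ ∑ i, ‖fderiv ℝ f x (EuclideanSpace.basisFun (Fin 3) ℝ i)‖ := by
  set eb := EuclideanSpace.basisFun (Fin 3) ℝ with heb
  have hnorm : ∀ i, ‖(eb i : (EuclideanSpace ℝ (Fin 3)))‖ = 1 := fun i => eb.orthonormal.1 i
  refine ContinuousLinearMap.opNorm_le_bound _ (Finset.sum_nonneg fun i _ => norm_nonneg _)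
    fun v => ?_
  have hv := eb.sum_repr' v
  calc ‖fderiv ℝ f x v‖ = ‖fderiv ℝ f x (∑ i, ⟪eb i, v⟫ • (eb i : (EuclideanSpace ℝ (Fin 3))))‖ := by rw [hv]
    _ = ‖∑ i, ⟪eb i, v⟫ * fderiv ℝ f x (eb i)‖ := by
        rw [map_sum]; simp only [map_smul, smul_eq_mul]
    _ ≤ ∑ i, ‖⟪eb i, v⟫ * fderiv ℝ f x (eb i)‖ := norm_sum_le _ _
    _ ≤ ∑ i, ‖fderiv ℝ f x (eb i)‖ * ‖v‖ := by
        refine Finset.sum_le_sum fun i _ => ?_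
        rw [norm_mul, mul_comm]
        gcongr
        refine (abs_real_inner_le_norm _ _).trans ?_
        rw [hnorm, one_mul]
    _ = (∑ i, ‖fderiv ℝ f x (eb i)‖) * ‖v‖ := by rw [Finset.sum_mul]

/-- `‖Df(x)‖ ≤ Σₗ ‖∂ₗ f(x)‖` with the standard basis vectors `eₗ = single l 1`. [folklore] -/
theorem norm_fderiv_le_sum_single (f : (EuclideanSpace ℝ (Fin 3)) → ℝ) (x : (EuclideanSpace ℝ (Fin 3))) :
    ‖fderiv ℝ f x‖ ≤ ∑ l : Fin 3, ‖fderiv ℝ f x (EuclideanSpace.single (l : Fin 3) (1 : ℝ))‖ := by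
  simpa only [EuclideanSpace.basisFun_apply] using norm_fderiv_le_sum_basisFun f x

/-- **Interior mixed-norm bound for the pressure gradient** (the slice estimate
`eLpNorm_fderiv_pressure_ball_le` integrated in time; Seregin 2014, proof of Prop. 6.7, the
pressure half of (4.6.4) at the level of smooth functions). For `1 < s < ∞`, `1 ≤ n`, radii
`0 < ρ < R₁` and a spatial centre `x₀` there is `C` such that: for every time `t₁` and all jointly
continuous `P : ℝ × (EuclideanSpace ℝ (Fin 3)) → ℝ`, `F : ℝ × (EuclideanSpace ℝ (Fin 3)) → (EuclideanSpace ℝ (Fin 3))`, smooth in `x` with `D_xP` jointly continuous, such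
that `Δₓ P(t,·) = div F(t,·)` on `B(x₀,R₁)` for every `t ∈ ]t₁ - ρ², t₁[`,
`‖D_x P‖_{s,n,Q((t₁,x₀),ρ)} ≤ C (‖P‖_{s,n,Q((t₁,x₀),R₁)} + ‖F‖_{s,n,Q((t₁,x₀),R₁)})`
(operator norm of `D_xP` pointwise; Minkowski in `L_n` of the time interval). [cite: Seregin2014, §4.6 Prop. 6.7 (4.6.4), pressure term (proof p. 59)] -/
theorem mixedNorm_fderiv_pressure_le {s n : ℝ} (hs : 1 < s) (hn : 1 ≤ n) {ρ R₁ : ℝ}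
    (hρ : 0 < ρ) (hρR : ρ < R₁) (x₀ : (EuclideanSpace ℝ (Fin 3))) :
    ∃ C : ℝ≥0, ∀ (P : ℝ → (EuclideanSpace ℝ (Fin 3)) → ℝ) (F : ℝ → (EuclideanSpace ℝ (Fin 3)) → (EuclideanSpace ℝ (Fin 3))) (t₁ : ℝ),
      Continuous (uncurry P) → Continuous (uncurry F) →
      (∀ t, ContDiff ℝ ∞ (P t)) → (∀ t, ContDiff ℝ ∞ (F t)) →
      (∀ t ∈ Ioo (t₁ - ρ ^ 2) t₁, ∀ x ∈ ball x₀ R₁,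
        (Δ (P t)) x = VectorCalculus.divergence (F t) x) →
      mixedNorm s n ((t₁, x₀) : ℝ × (EuclideanSpace ℝ (Fin 3))) ρ (uncurry fun t x => fderiv ℝ (P t) x) ≤
        C * (mixedNorm s n ((t₁, x₀) : ℝ × (EuclideanSpace ℝ (Fin 3))) R₁ (uncurry P) +
          mixedNorm s n ((t₁, x₀) : ℝ × (EuclideanSpace ℝ (Fin 3))) R₁ (uncurry F)) := by
  have hs0 : 0 < s := by linarith
  have hn0 : 0 < n := by linarith
  set p : ℝ≥0∞ := ENNReal.ofReal s with hpdef
  have hp : 1 < p := by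
    rw [hpdef, ← ENNReal.ofReal_one]; exact (ENNReal.ofReal_lt_ofReal_iff hs0).2 hs
  have hp' : p < ⊤ := ENNReal.ofReal_lt_top
  have hp0 : p ≠ 0 := (zero_lt_one.trans hp).ne'
  have hptr : p.toReal = s := ENNReal.toReal_ofReal hs0.le
  obtain ⟨C, hC⟩ := eLpNorm_fderiv_pressure_ball_le hp hp' hρ hρR x₀
  refine ⟨3 * C, fun P F t₁ hPc hFc hP hF hEq => ?_⟩
  -- slice quantities
  set A₁ : ℝ → ℝ≥0∞ := fun t => (∫⁻ x in ball x₀ R₁, ‖P t x‖ₑ ^ s) ^ (1 / s) with hA₁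
  set A₂ : ℝ → ℝ≥0∞ := fun t => (∫⁻ x in ball x₀ R₁, ‖F t x‖ₑ ^ s) ^ (1 / s) with hA₂
  have hPm : Measurable (uncurry P) := hPc.measurable
  have hFm : Measurable (uncurry F) := hFc.measurable
  have hA₁m : Measurable A₁ :=
    ((hPm.enorm.pow_const s).lintegral_prod_right' (ν := volume.restrict (ball x₀ R₁))).pow_const _
  have hA₂m : Measurable A₂ :=
    ((hFm.enorm.pow_const s).lintegral_prod_right' (ν := volume.restrict (ball x₀ R₁))).pow_const _
  have heP : ∀ t, eLpNorm (P t) p (volume.restrict (ball x₀ R₁)) = A₁ t := fun t => by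
    rw [eLpNorm_eq_lintegral_rpow_enorm_toReal hp0 hp'.ne, hptr]
  have heF : ∀ t, eLpNorm (F t) p (volume.restrict (ball x₀ R₁)) = A₂ t := fun t => by
    rw [eLpNorm_eq_lintegral_rpow_enorm_toReal hp0 hp'.ne, hptr]
  -- the slice bound
  have hslice : ∀ t ∈ Ioo (t₁ - ρ ^ 2) t₁,
      (∫⁻ x in ball x₀ ρ, ‖fderiv ℝ (P t) x‖ₑ ^ s) ^ (1 / s) ≤
        ((3 * C : ℝ≥0) : ℝ≥0∞) * (A₁ t + A₂ t) := by
    intro t ht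
    have h1 : (∫⁻ x in ball x₀ ρ, ‖fderiv ℝ (P t) x‖ₑ ^ s) ^ (1 / s) =
        eLpNorm (fun x => fderiv ℝ (P t) x) p (volume.restrict (ball x₀ ρ)) := by
      rw [eLpNorm_eq_lintegral_rpow_enorm_toReal hp0 hp'.ne, hptr]
    rw [h1]
    have hl : ∀ l : Fin 3, eLpNorm (fun x => fderiv ℝ (P t) x (EuclideanSpace.single (l : Fin 3) (1 : ℝ))) p
        (volume.restrict (ball x₀ ρ)) ≤ C * (A₁ t + A₂ t) := fun l => by
      rw [← heP t, ← heF t]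
      exact hC (P t) (F t) (hP t) (hF t) (hEq t ht) (EuclideanSpace.single (l : Fin 3) (1 : ℝ)) (norm_single_one l).le
    set G : Fin 3 → (EuclideanSpace ℝ (Fin 3)) → ℝ := fun l x => ‖fderiv ℝ (P t) x (EuclideanSpace.single (l : Fin 3) (1 : ℝ))‖ with hG
    have hmeas : ∀ l : Fin 3, AEStronglyMeasurable (G l) (volume.restrict (ball x₀ ρ)) :=
      fun l => ((((hP t).continuous_fderiv (by norm_cast)).clm_apply
        continuous_const).norm).aestronglyMeasurable
    calc eLpNorm (fun x => fderiv ℝ (P t) x) p (volume.restrict (ball x₀ ρ))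
        ≤ eLpNorm (∑ l : Fin 3, G l) p (volume.restrict (ball x₀ ρ)) := by
          refine eLpNorm_mono_real fun x => ?_
          rw [Finset.sum_apply]
          exact norm_fderiv_le_sum_single (P t) x
      _ ≤ ∑ l : Fin 3, eLpNorm (G l) p (volume.restrict (ball x₀ ρ)) :=
          eLpNorm_sum_le (fun l _ => hmeas l) hp.le
      _ ≤ ∑ _l : Fin 3, (C : ℝ≥0∞) * (A₁ t + A₂ t) := by
          refine Finset.sum_le_sum fun l _ => ?_
          rw [hG, eLpNorm_norm]
          exact hl l
      _ = ((3 * C : ℝ≥0) : ℝ≥0∞) * (A₁ t + A₂ t) := by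
          rw [Finset.sum_const, Finset.card_univ, Fintype.card_fin]
          push_cast
          ring
  -- integrate in time
  have hpow : ∀ a : ℝ≥0∞, a ^ (n / s) = (a ^ (1 / s)) ^ n := fun a => by
    rw [← ENNReal.rpow_mul, one_div_mul_eq_div]
  have hρR2 : ρ ^ 2 ≤ R₁ ^ 2 := by nlinarith
  have hCtop : (((3 * C : ℝ≥0) : ℝ≥0∞)) ^ n ≠ ⊤ :=
    ENNReal.rpow_ne_top_of_nonneg hn0.le ENNReal.coe_ne_top
  unfold mixedNorm
  simp only [uncurry_apply_pair]
  calc (∫⁻ t in Ioo (t₁ - ρ ^ 2) t₁, (∫⁻ x in ball x₀ ρ, ‖fderiv ℝ (P t) x‖ₑ ^ s) ^ (n / s)) ^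
        (1 / n)
      ≤ (∫⁻ t in Ioo (t₁ - ρ ^ 2) t₁, (((3 * C : ℝ≥0) : ℝ≥0∞) * (A₁ t + A₂ t)) ^ n) ^ (1 / n) := by
        refine ENNReal.rpow_le_rpow (setLIntegral_mono' measurableSet_Ioo fun t ht => ?_)
          (by positivity)
        rw [hpow]
        exact ENNReal.rpow_le_rpow (hslice t ht) hn0.le
    _ ≤ (∫⁻ t in Ioo (t₁ - R₁ ^ 2) t₁, (((3 * C : ℝ≥0) : ℝ≥0∞) * (A₁ t + A₂ t)) ^ n) ^ (1 / n) :=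
        ENNReal.rpow_le_rpow (lintegral_mono_set (Ioo_subset_Ioo_left (by linarith)))
          (by positivity)
    _ = ((3 * C : ℝ≥0) : ℝ≥0∞) * (∫⁻ t in Ioo (t₁ - R₁ ^ 2) t₁, (A₁ t + A₂ t) ^ n) ^ (1 / n) := by
        simp_rw [ENNReal.mul_rpow_of_nonneg _ _ hn0.le]
        rw [lintegral_const_mul' _ _ hCtop, ENNReal.mul_rpow_of_nonneg _ _ (by positivity),
          ← ENNReal.rpow_mul, mul_one_div_cancel hn0.ne', ENNReal.rpow_one]
    _ ≤ ((3 * C : ℝ≥0) : ℝ≥0∞) * ((∫⁻ t in Ioo (t₁ - R₁ ^ 2) t₁, A₁ t ^ n) ^ (1 / n) +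
          (∫⁻ t in Ioo (t₁ - R₁ ^ 2) t₁, A₂ t ^ n) ^ (1 / n)) := by
        gcongr
        exact ENNReal.lintegral_Lp_add_le hA₁m.aemeasurable hA₂m.aemeasurable hn
    _ = _ := by simp only [hA₁, hA₂, ← hpow]

end Mixed

end Literature.Analysis.FluidPDE

end
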